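import Summits.Ventures.YMGap.RobustBall.IsingBallD3
import Summits.Ventures.YMGap.RobustBall.IsingBallB2Bound
import HarnessLib

/-!
# RobustBall/IsingBallD3Bound — boundary two-point functions of the ball `B₂ ⊂ ℤ²` (heat bath), Griffiths monotonicity, and the `d = 3` rung-3
# Simon–Lieb bound `3·∑_axis ⟨σ_0σ_x⟩ + 2·∑_corner ⟨σ_0σ_x⟩ ≤ 3.15716…` for `0 ≤ β ≤ artanh(6/19)`

HONEST FRAMING: venture file of the cell `pub-ymgap` (QuantumFields programme), track Y2 ROBUST-BALL / DS seat ds-4 (g10).  Finite statements about the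
free-boundary, zero-field Ising model on the explicit 13-vertex graph `BallD3.graph` (`IsingBallD3`); the `d = 3` twin of `IsingBallB2Bound`.

WHAT.  (i) Heat bath at the 8 boundary sites (tree `isingExpect_spinAt_mul_eq_tanh`): `⟨σ_0 σ_{±2e_k}⟩ = tanh β · ⟨σ_0 σ_{±e_k}⟩`,
`⟨σ_0 σ_{±e_0 ± e_1}⟩ = ½ tanh 2β · (⟨σ_0σ_{±e_0}⟩ + ⟨σ_0σ_{±e_1}⟩)`; so the BOUNDARY SUM `3·∑_axis + 2·∑_corner = (3 tanh β + 2 tanh 2β) · ∑_m ⟨σ_0σ_m⟩`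
(`boundarySum_eq`; `3` and `2` = numbers of `ℤ²`-neighbours of an axis / corner site outside the ball).  (ii) Griffiths monotonicity in `β`
(`boundarySum_mono`).  (iii) With the exact core number at `β₃ = artanh(6/19)`: **`boundarySum_le`**: boundary sum `≤ B₃ = 20216932395120/6403517520841
= 3.157166…` on `[0, β₃]`, and `(6/19)·B₃ = 0.996998… < 1` (`rate3_lt_one`); the root of the certificate is `β_W ≈ 0.3273`, `β₃ = 0.326962`.

References: B. Simon, Comm. Math. Phys. 77 (1980) 111; E. Lieb, Comm. Math. Phys. 77 (1980) 127; A. van Enter, R. Fernández, A. Sokal, J. Stat.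
Phys. 72 (1993) 879, eq. (4.6); R. Griffiths, J. Math. Phys. 8 (1967) 478, 484.
-/

noncomputable section

open Finset
open Literature.Probability.LatticeModels

namespace Summit.Ventures.YMGap.RobustBall

namespace BallD3

open V

/-! ### Neighbourhoods of the boundary sites -/

/-- The only neighbour of the axis site `±2e_k` in the ball is `±e_k`. [folklore] -/
theorem neighborFinset_axis (k : Fin 2) (s : Bool) : graph.neighborFinset (axis k s) = {mid k s} := by
  ext q
  rw [SimpleGraph.mem_neighborFinset, graph_adj, mem_singleton]
  cases q <;> simp [V.adj, eq_comm]

/-- The two neighbours of the corner `±e_0 ± e_1` in the ball. [folklore] -/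
theorem neighborFinset_corner (s s' : Bool) : graph.neighborFinset (corner s s') = {mid 0 s, mid 1 s'} := by
  ext q
  rw [SimpleGraph.mem_neighborFinset, graph_adj, mem_insert, mem_singleton]
  cases q <;> simp [V.adj]

/-- The two neighbours of a corner are distinct. [folklore] -/
theorem mid_zero_ne_mid_one (s s' : Bool) : mid 0 s ≠ mid 1 s' := by
  intro h
  simp only [mid.injEq] at h
  exact absurd h.1 (by decide)

/-! ### Heat-bath reduction of the boundary two-point functions -/

/-- The two-point function is symmetric in its two sites. [folklore] -/
theorem isingTwoPoint_comm' (β : ℝ) (x y : V) : isingTwoPoint graph univ β 0 .free x y = isingTwoPoint graph univ β 0 .free y x := by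
  unfold isingTwoPoint spinPair; congr 1; funext σ; ring

/-- **Axis sites**: `⟨σ_0 σ_{±2e_k}⟩^∅ = tanh β · ⟨σ_0 σ_{±e_k}⟩^∅`. [cite: VanenterFernandezSokal1993, §4.1.2 Step 2, eq. (4.6)] -/
theorem isingTwoPoint_centre_axis (β : ℝ) (k : Fin 2) (s : Bool) :
    isingTwoPoint graph univ β 0 .free centre (axis k s) = Real.tanh β * isingTwoPoint graph univ β 0 .free centre (mid k s) := by
  rw [isingTwoPoint_comm' β centre (axis k s), isingTwoPoint_comm' β centre (mid k s)]
  unfold isingTwoPoint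
  rw [← isingExpect_univ_fixed graph β 0 1, ← isingExpect_univ_fixed graph β 0 1 (spinPair (mid k s) centre)]
  have h := isingExpect_spinAt_mul_eq_tanh graph (mem_univ (axis k s)) β 1 (g := spinAt centre) (measurable_spinAt centre)
    (fun σ u => by simp [spinAt])
  have hfun : (fun σ : SpinConfig V => Real.tanh (β * ∑ y ∈ graph.neighborFinset (axis k s), spinAt y σ) * spinAt centre σ) =
      fun σ => Real.tanh β * spinPair (mid k s) centre σ := by
    funext σ
    rw [neighborFinset_axis, sum_singleton]
    simp only [spinPair, spinAt]
    rw [tanh_mul_spin]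
    ring
  rw [show (spinPair (axis k s) centre : SpinConfig V → ℝ) = fun σ => spinAt (axis k s) σ * spinAt centre σ from rfl, h, hfun,
    isingExpect_const_mul' graph univ 0 _ β _ (measurable_spinPair (mid k s) centre)]

/-- **Corner sites**: `⟨σ_0 σ_{±e_0 ± e_1}⟩^∅ = ½ tanh 2β · (⟨σ_0 σ_{±e_0}⟩ + ⟨σ_0 σ_{±e_1}⟩)`. [cite: VanenterFernandezSokal1993, §4.1.2 Step 2, eq. (4.6)] -/
theorem isingTwoPoint_centre_corner (β : ℝ) (s s' : Bool) :
    isingTwoPoint graph univ β 0 .free centre (corner s s') =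
      Real.tanh (2 * β) / 2 * (isingTwoPoint graph univ β 0 .free centre (mid 0 s) + isingTwoPoint graph univ β 0 .free centre (mid 1 s')) := by
  rw [isingTwoPoint_comm' β centre (corner s s'), isingTwoPoint_comm' β centre (mid 0 s), isingTwoPoint_comm' β centre (mid 1 s')]
  unfold isingTwoPoint
  rw [← isingExpect_univ_fixed graph β 0 1, ← isingExpect_univ_fixed graph β 0 1 (spinPair (mid 0 s) centre),
    ← isingExpect_univ_fixed graph β 0 1 (spinPair (mid 1 s') centre)]
  have h := isingExpect_spinAt_mul_eq_tanh graph (mem_univ (corner s s')) β 1 (g := spinAt centre) (measurable_spinAt centre)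
    (fun σ u => by simp [spinAt])
  have hfun : (fun σ : SpinConfig V => Real.tanh (β * ∑ y ∈ graph.neighborFinset (corner s s'), spinAt y σ) * spinAt centre σ) =
      fun σ => Real.tanh (2 * β) / 2 * (spinPair (mid 0 s) centre σ + spinPair (mid 1 s') centre σ) := by
    funext σ
    rw [neighborFinset_corner, sum_pair (mid_zero_ne_mid_one s s')]
    simp only [spinPair, spinAt]
    rw [tanh_mul_spin_add_spin]
    ring
  rw [show (spinPair (corner s s') centre : SpinConfig V → ℝ) = fun σ => spinAt (corner s s') σ * spinAt centre σ from rfl, h, hfun,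
    isingExpect_const_mul' graph univ 0 _ β _ (f := fun σ => spinPair (mid 0 s) centre σ + spinPair (mid 1 s') centre σ)
      ((measurable_spinPair _ centre).add (measurable_spinPair _ centre)),
    isingExpect_add' graph univ 0 _ β (measurable_spinPair _ centre) (measurable_spinPair _ centre)]

/-- **THE BOUNDARY SUM IN CLOSED FORM** (`d = 3`): `3·∑_axis + 2·∑_corner = (3 tanh β + 2 tanh 2β) · ∑_m ⟨σ_0σ_m⟩`. [folklore] -/
theorem boundarySum_eq (β : ℝ) :
    3 * ∑ ks : Fin 2 × Bool, isingTwoPoint graph univ β 0 .free centre (axis ks.1 ks.2) +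
        2 * ∑ c : Bool × Bool, isingTwoPoint graph univ β 0 .free centre (corner c.1 c.2) =
      (3 * Real.tanh β + 2 * Real.tanh (2 * β)) * ∑ ks : Fin 2 × Bool, isingTwoPoint graph univ β 0 .free centre (mid ks.1 ks.2) := by
  simp only [isingTwoPoint_centre_axis, isingTwoPoint_centre_corner]
  simp only [Fintype.sum_prod_type, Fin.sum_univ_two, Fintype.sum_bool]
  ring

/-! ### Griffiths monotonicity in `β` -/

/-- **`β ↦ ⟨σ_0 σ_x⟩^∅_{B₂;β}` is nondecreasing on `[0, ∞)`** (GKS II). [cite: FriedliVelenik2017, Theorem 3.20] -/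
theorem isingTwoPoint_centre_mono {β β' : ℝ} (h0 : 0 ≤ β) (h : β ≤ β') (x : V) :
    isingTwoPoint graph univ β 0 .free centre x ≤ isingTwoPoint graph univ β' 0 .free centre x := by
  by_cases hx : centre = x
  · subst hx; simp
  rw [isingTwoPoint_eq_isingCorr _ _ _ _ _ hx, isingTwoPoint_eq_isingCorr _ _ _ _ _ hx]
  exact monotoneOn_isingCorr_free graph (fun _ _ _ _ _ _ => GKSInequalities.gks_two_holds graph) le_rfl (subset_univ _)
    (Set.mem_Ici.2 h0) (Set.mem_Ici.2 (h0.trans h)) h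

/-- **The boundary sum is nondecreasing in `β ≥ 0`.** [cite: FriedliVelenik2017, Theorem 3.20] -/
theorem boundarySum_mono {β β' : ℝ} (h0 : 0 ≤ β) (h : β ≤ β') :
    3 * ∑ ks : Fin 2 × Bool, isingTwoPoint graph univ β 0 .free centre (axis ks.1 ks.2) +
        2 * ∑ c : Bool × Bool, isingTwoPoint graph univ β 0 .free centre (corner c.1 c.2) ≤
      3 * ∑ ks : Fin 2 × Bool, isingTwoPoint graph univ β' 0 .free centre (axis ks.1 ks.2) +
        2 * ∑ c : Bool × Bool, isingTwoPoint graph univ β' 0 .free centre (corner c.1 c.2) := by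
  gcongr with ks _ c _
  · exact isingTwoPoint_centre_mono h0 h _
  · exact isingTwoPoint_centre_mono h0 h _

/-! ### Row at `β₃ = artanh(6/19)` -/

/-- **The `d = 3` rung-3 bound** `B₃ = (3·(6/19) + 2·(228/397)) · ∑_m⟨σ_0σ_m⟩_{β₃} = 20216932395120 / 6403517520841 = 3.157166…`. [folklore] -/
def bound3 : ℝ := 20216932395120 / 6403517520841

/-- **The `d = 3` rung-3 rate** `φ₃ = (6/19) · B₃ = 0.996998…`. [folklore] -/
def rate3 : ℝ := 6 / 19 * bound3

/-- `φ₃ < 1`. [folklore] -/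
theorem rate3_lt_one : rate3 < 1 := by unfold rate3 bound3; norm_num

/-- `0 < φ₃`. [folklore] -/
theorem rate3_pos : 0 < rate3 := by unfold rate3 bound3; norm_num

/-- **THE `d = 3` RUNG-3 SIMON–LIEB BOUND**: for `0 ≤ β ≤ β₃ = artanh(6/19)`,
`3 · ∑_{axis x} ⟨σ_0σ_x⟩^∅_{B₂;β} + 2 · ∑_{corner x} ⟨σ_0σ_x⟩^∅_{B₂;β} ≤ B₃ = 3.157166…`. [cite: DuminilCopinTassionCMP2016, Lemma 2.7] -/
theorem boundarySum_le {β : ℝ} (h0 : 0 ≤ β) (hβ : β ≤ beta3) :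
    3 * ∑ ks : Fin 2 × Bool, isingTwoPoint graph univ β 0 .free centre (axis ks.1 ks.2) +
        2 * ∑ c : Bool × Bool, isingTwoPoint graph univ β 0 .free centre (corner c.1 c.2) ≤ bound3 := by
  refine (boundarySum_mono h0 hβ).trans (le_of_eq ?_)
  rw [boundarySum_eq, sum_isingTwoPoint_centre_mid_eq, tanh_two_mul', tanh_beta3, bound3]
  norm_num

end BallD3

end Summit.Ventures.YMGap.RobustBall

end
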